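import Summits.QuantumFields.BalabanUV.Beta.EriceRemainderEnclosureHistoryAutonomyComparisonAgeCompositionNestedTwoPairs

/-!
# EriceRemainderEnclosureHistoryAutonomyComparisonAgeCompositionTwoPairsBandsH — (E93l) route (N), first order: RATIONAL BANDS OF THE JOINT TWO-PAIR CERTIFICATE, FAR REGIME, PART H.  Instances of (E93b)
# `flow_nonneg_census_three_ages_two_pairs` for bands `K_lo ≤ k₂ ≤ K_hi`, `r_lo(k₂+1) ≤ k₃+1` (`2(k₂+1) ≤ k₃` when `r_lo = 2`),
# `k₃+1 ≤ r_hi(k₂+1)` of the census three ages (1, k₂, k₃): in each band the parameters are worst-case RATIONAL bounds — `s = 0.70715 ≥ √2∕2`,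
# `σ₁ ≥ (99∕70)∕(1+p₁)` with `p₁⁴(K_hi+1) ≤ 2`, `σ₂ ≥ (99∕70)∕(1+p₂)` with `p₂⁴r_hi ≤ 1`, `E ≥ 2(k₂+1)∕k₃`, `B = 4∕K_lo`, `C ≥ 4∕k₃` — and the
# certificate data `b₁, a₂, ρ₁…ρ₄` are exact rationals checked by `norm_num` (generator `HOME/b2b-balaban-beta-d4-p2/g83/numerics/band_lean.py`;
# every margin > 0 in exact arithmetic).  THE END `0 ≤ ε ≤ e` along every admissible flow, every horizon, every damping of the self-consistent class,
# for every `(k₂, k₃)` of the band.  Parts A–E, H, I cover `17 ≤ k₂ ≤ 45` from `k₃ = max(57, 2k₂+2)` up to ratio `100` (`50` for `k₂ ≥ 40`); with the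
# near bands (parts F, G), (E90c), and (E92g) they give (E93k) `flow_nonneg_census_three_ages_from_seventeen`

Cell `pub-balaban`, β-function sub-cell, BINDER row D4 «RemainderConst leaves for Bałaban's split» (`HOME/BINDER-OWNERS.md`; owner lineage `b2b-balaban-beta-an4`;
this file by co-owner #2 lineage `b2b-balaban-beta-d4-p2`, generation 83), β-FLOW TEAM duty (1), FREEZE (0) honoured (def-free; nothing restated).

HONEST FRAMING (page 1, verbatim and binding).  *"Discharging BetaPertH makes Bałaban's UV stability UNCONDITIONAL — a real constructive-QFT result; it is
NOT the continuum limit and NOT the Clay problem."*  THIS FILE DISCHARGES NOTHING OF THE KIND.  Elementary real algebra ∕ real analysis about ABSTRACT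
functionals on a box ]0,γ]^ℕ with displayed floors, profiles and signs, and the FIRST-ORDER renewal objects of route (N) built from them — hypotheses of a
census, not facts; the form, signs, ages and moments of Bałaban's (1.22) limit functional are NOT PRINTED ([I] p. 298; GAPS G-t4-U2-1∕-2) and NOT asserted.
Row D4 class UNCHANGED (critical-path width 0; instance 0∕1; D4 DISCHARGE NO DATE); NOT B12 Thm 2, NOT BetaPertH, NOT continuum, NOT Clay.

WHAT IS PROVED ([folklore]; 0 `def`, 0 sorry).  `joint_band_k17_17_r29_9_10_3`, `joint_band_k17_17_r10_3_7_2`, `joint_band_k17_17_r7_2_15_4`, `joint_band_k17_17_r15_4_17_4`.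
-/
noncomputable section
open Finset

namespace Summit.QuantumFields.BalabanUV.Beta.EriceRemainderEnclosureHistoryAutonomyComparisonAgeCompositionTwoPairsBandsH

open Literature.MathematicalPhysics.QuantumFieldTheory.Balaban1983to89
open Literature.MathematicalPhysics.QuantumFieldTheory.Balaban1983to89.T4BetaStationary
open Literature.MathematicalPhysics.QuantumFieldTheory.Balaban1983to89.T4BetaFlowWellPosed
open Summit.QuantumFields.BalabanUV.Beta.EriceRemainderEnclosureHistoryAutonomyComparisonAgeCompositionNestedTwoPairs (flow_nonneg_census_three_ages_two_pairs)

variable {B : (ℕ → ℝ) → ℝ} {γ b gIR : ℝ} {L : ℕ → ℝ} {K : ℕ} {h g : ℕ → ℝ}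

/-- **JOINT BAND `17 ≤ k₂ ≤ 17`, `29/9·(k₂+1) ≤ k₃`, `k₃+1 ≤ 10/3·(k₂+1)` ⟹ THE END** ((E93b) `flow_nonneg_census_three_ages_two_pairs` with
`s = 14143/20000`, `p₁ = 5773/10000`, `σ₁ = 17933/20000`, `p₂ = 37/50`, `σ₂ = 81281/100000`, `E = 12/19`, `B = 4/17`, `C = 4/57`; exact rational certificate, margin `0.0004`). [folklore] -/
theorem joint_band_k17_17_r29_9_10_3 (hmono : ∀ u v : ℕ → ℝ, SeqBox γ u → SeqBox γ v → (∀ j, u j ≤ v j) → B u ≤ B v)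
    (hL : ∀ k, 0 ≤ L k) (hb : 0 < b) (hlo : ∀ u, SeqBox γ u → b ≤ B u) (hdom : ∀ u, SeqBox γ u → ∑ k ∈ range K, L k * u k ≤ B u)
    (hh : SeqBox γ h) (hf : MemFlow B gIR h) (hg : ∀ t, 0 < g t ∧ g t ≤ 1)
    (hgF : ∀ t, 1 ≤ g t * (1 + ∑ k ∈ range K, L k * h (t + k) ^ 3 / 2))
    {k₂ k₃ : ℕ} (hk2lo : 17 ≤ k₂) (hk2hi : k₂ ≤ 17) (hrlo : 29 * (k₂ + 1) ≤ 9 * (k₃ + 1)) (hrhi : 3 * (k₃ + 1) ≤ 10 * (k₂ + 1)) (hk3K : k₃ < K)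
    (hL3 : ∀ j, j < K → j ≠ 1 → j ≠ k₂ → j ≠ k₃ → L j = 0)
    {N : ℕ} {KL : ℕ → ℕ → ℕ → ℝ}
    (hKL : ∀ k n l, KL k n l = if 0 < k ∧ k < K ∧ l < k then L k * h (n + k) ^ 3 / 2 * ∏ t ∈ Ico (n + 1 + l) (n + k + 1), g t else 0)
    {KA : ℕ → ℕ → ℕ → ℝ} {RA : ℕ → (ℕ → ℝ) → ℕ → ℝ}
    (hRA : ∀ i v m, RA i v m = ∑ l ∈ range K, KA i m l * v (m + 1 + l))
    (hKA : ∀ i m l, KA i m l = KL i m l + KA (i + 1) m l) (hKAtop : ∀ m l, KA K m l = 0)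
    {e ε : ℕ → ℝ} (he0 : ∀ m, 0 ≤ e m) (hea : ∀ m, e (m + 1) ≤ e m)
    (hεt : ∀ m, N < m → ε m = 0) (hεrec : ∀ m, ε m = e m - RA 1 ε m) : ∀ m, 0 ≤ ε m ∧ ε m ≤ e m := by
  have hs99 : Real.sqrt 2 ≤ 99 / 70 := Real.sqrt_le_iff.mpr ⟨by norm_num, by norm_num⟩
  have hk2lo' : (17 : ℝ) ≤ k₂ := by exact_mod_cast hk2lo
  have hk2hi' : (k₂ : ℝ) ≤ 17 := by exact_mod_cast hk2hi
  have hrlo' : (29 : ℝ) * ((k₂ : ℝ) + 1) ≤ 9 * ((k₃ : ℝ) + 1) := by exact_mod_cast hrlo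
  have hrhi' : (3 : ℝ) * ((k₃ : ℝ) + 1) ≤ 10 * ((k₂ : ℝ) + 1) := by exact_mod_cast hrhi
  have hk3pos : (0 : ℝ) < k₃ := by exact_mod_cast (show 0 < k₃ by omega)
  refine flow_nonneg_census_three_ages_two_pairs hmono hL hb hlo hdom hh hf hg hgF (by omega) (by omega) hk3K hL3
    (p₁ := ((5773 : ℝ) / 10000)) (p₂ := ((37 : ℝ) / 50)) (by norm_num) ?_ (by norm_num) ?_
    (s := ((14143 : ℝ) / 20000)) (σ₁ := ((17933 : ℝ) / 20000)) (σ₂ := ((81281 : ℝ) / 100000)) (E := ((12 : ℝ) / 19)) (Bc := ((4 : ℝ) / 17)) (Cc := ((4 : ℝ) / 57))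
    (by linarith [hs99]) (by norm_num) ?_ ?_ ?_ (by norm_num) ?_ ?_ (by norm_num)
    (b₁ := ((5283 : ℝ) / 50000)) (a₂ := ((379 : ℝ) / 2000)) (ρ₁ := ((4079632283 : ℝ) / 19000000000)) (ρ₂ := ((4079632283 : ℝ) / 19000000000)) (ρ₃ := ((4079632283 : ℝ) / 19000000000)) (ρ₄ := ((4079632283 : ℝ) / 19000000000))
    (Or.inr (by norm_num)) (by norm_num) (by norm_num) (by norm_num)
    (fun h => absurd h (by norm_num)) (fun h => absurd h (by norm_num)) (fun h => absurd h (by norm_num)) (fun h => absurd h (by norm_num))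
    (fun _ => by norm_num) (fun _ => by norm_num) (fun _ => by norm_num) (fun _ => by norm_num)
    (Or.inl (by norm_num)) (by norm_num) (by norm_num) (by norm_num) (by norm_num) (by norm_num)
    hKL hRA hKA hKAtop he0 hea hεt hεrec
  · -- p₁⁴(k₂+1) ≤ 2
    have h1 : ((5773 : ℝ) / 10000) ^ 4 * ((k₂ : ℝ) + 1) ≤ ((5773 : ℝ) / 10000) ^ 4 * ((17 : ℝ) + 1) := mul_le_mul_of_nonneg_left (by linarith) (by positivity)
    have h2 : ((5773 : ℝ) / 10000) ^ 4 * ((17 : ℝ) + 1) ≤ 2 := by norm_num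
    linarith
  · -- p₂⁴(k₃+1) ≤ k₂+1
    have t := mul_le_mul_of_nonneg_left hrhi' (show (0 : ℝ) ≤ ((37 : ℝ) / 50) ^ 4 / 3 by norm_num)
    have h2 : ((37 : ℝ) / 50) ^ 4 / 3 * 10 ≤ 1 := by norm_num
    have h3 := mul_le_mul_of_nonneg_right h2 (show (0 : ℝ) ≤ (k₂ : ℝ) + 1 by positivity)
    linarith [t, h3]
  · -- √2∕(1+p₁) ≤ σ₁
    rw [div_le_iff₀ (by norm_num)]; linarith [hs99]
  · -- √2∕(1+p₂) ≤ σ₂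
    rw [div_le_iff₀ (by norm_num)]; linarith [hs99]
  · -- 2(k₂+1)∕k₃ ≤ E
    rw [div_le_iff₀ hk3pos]; linarith [hrlo']
  · -- 4∕k₂ ≤ B
    exact div_le_div_of_nonneg_left (by norm_num) (by norm_num) hk2lo'
  · -- 4∕k₃ ≤ C
    rw [div_le_iff₀ hk3pos]; linarith [hrlo', hk2lo']

/-- **JOINT BAND `17 ≤ k₂ ≤ 17`, `10/3·(k₂+1) ≤ k₃`, `k₃+1 ≤ 7/2·(k₂+1)` ⟹ THE END** ((E93b) `flow_nonneg_census_three_ages_two_pairs` with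
`s = 14143/20000`, `p₁ = 5773/10000`, `σ₁ = 17933/20000`, `p₂ = 7311/10000`, `σ₂ = 81699/100000`, `E = 36/59`, `B = 4/17`, `C = 4/59`; exact rational certificate, margin `0.0008`). [folklore] -/
theorem joint_band_k17_17_r10_3_7_2 (hmono : ∀ u v : ℕ → ℝ, SeqBox γ u → SeqBox γ v → (∀ j, u j ≤ v j) → B u ≤ B v)
    (hL : ∀ k, 0 ≤ L k) (hb : 0 < b) (hlo : ∀ u, SeqBox γ u → b ≤ B u) (hdom : ∀ u, SeqBox γ u → ∑ k ∈ range K, L k * u k ≤ B u)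
    (hh : SeqBox γ h) (hf : MemFlow B gIR h) (hg : ∀ t, 0 < g t ∧ g t ≤ 1)
    (hgF : ∀ t, 1 ≤ g t * (1 + ∑ k ∈ range K, L k * h (t + k) ^ 3 / 2))
    {k₂ k₃ : ℕ} (hk2lo : 17 ≤ k₂) (hk2hi : k₂ ≤ 17) (hrlo : 10 * (k₂ + 1) ≤ 3 * (k₃ + 1)) (hrhi : 2 * (k₃ + 1) ≤ 7 * (k₂ + 1)) (hk3K : k₃ < K)
    (hL3 : ∀ j, j < K → j ≠ 1 → j ≠ k₂ → j ≠ k₃ → L j = 0)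
    {N : ℕ} {KL : ℕ → ℕ → ℕ → ℝ}
    (hKL : ∀ k n l, KL k n l = if 0 < k ∧ k < K ∧ l < k then L k * h (n + k) ^ 3 / 2 * ∏ t ∈ Ico (n + 1 + l) (n + k + 1), g t else 0)
    {KA : ℕ → ℕ → ℕ → ℝ} {RA : ℕ → (ℕ → ℝ) → ℕ → ℝ}
    (hRA : ∀ i v m, RA i v m = ∑ l ∈ range K, KA i m l * v (m + 1 + l))
    (hKA : ∀ i m l, KA i m l = KL i m l + KA (i + 1) m l) (hKAtop : ∀ m l, KA K m l = 0)
    {e ε : ℕ → ℝ} (he0 : ∀ m, 0 ≤ e m) (hea : ∀ m, e (m + 1) ≤ e m)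
    (hεt : ∀ m, N < m → ε m = 0) (hεrec : ∀ m, ε m = e m - RA 1 ε m) : ∀ m, 0 ≤ ε m ∧ ε m ≤ e m := by
  have hs99 : Real.sqrt 2 ≤ 99 / 70 := Real.sqrt_le_iff.mpr ⟨by norm_num, by norm_num⟩
  have hk2lo' : (17 : ℝ) ≤ k₂ := by exact_mod_cast hk2lo
  have hk2hi' : (k₂ : ℝ) ≤ 17 := by exact_mod_cast hk2hi
  have hrlo' : (10 : ℝ) * ((k₂ : ℝ) + 1) ≤ 3 * ((k₃ : ℝ) + 1) := by exact_mod_cast hrlo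
  have hrhi' : (2 : ℝ) * ((k₃ : ℝ) + 1) ≤ 7 * ((k₂ : ℝ) + 1) := by exact_mod_cast hrhi
  have hk3pos : (0 : ℝ) < k₃ := by exact_mod_cast (show 0 < k₃ by omega)
  refine flow_nonneg_census_three_ages_two_pairs hmono hL hb hlo hdom hh hf hg hgF (by omega) (by omega) hk3K hL3
    (p₁ := ((5773 : ℝ) / 10000)) (p₂ := ((7311 : ℝ) / 10000)) (by norm_num) ?_ (by norm_num) ?_
    (s := ((14143 : ℝ) / 20000)) (σ₁ := ((17933 : ℝ) / 20000)) (σ₂ := ((81699 : ℝ) / 100000)) (E := ((36 : ℝ) / 59)) (Bc := ((4 : ℝ) / 17)) (Cc := ((4 : ℝ) / 59))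
    (by linarith [hs99]) (by norm_num) ?_ ?_ ?_ (by norm_num) ?_ ?_ (by norm_num)
    (b₁ := ((1373 : ℝ) / 12500)) (a₂ := ((379 : ℝ) / 2000)) (ρ₁ := ((3146019297 : ℝ) / 14750000000)) (ρ₂ := ((3146019297 : ℝ) / 14750000000)) (ρ₃ := ((3146019297 : ℝ) / 14750000000)) (ρ₄ := ((3146019297 : ℝ) / 14750000000))
    (Or.inr (by norm_num)) (by norm_num) (by norm_num) (by norm_num)
    (fun h => absurd h (by norm_num)) (fun h => absurd h (by norm_num)) (fun h => absurd h (by norm_num)) (fun h => absurd h (by norm_num))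
    (fun _ => by norm_num) (fun _ => by norm_num) (fun _ => by norm_num) (fun _ => by norm_num)
    (Or.inl (by norm_num)) (by norm_num) (by norm_num) (by norm_num) (by norm_num) (by norm_num)
    hKL hRA hKA hKAtop he0 hea hεt hεrec
  · -- p₁⁴(k₂+1) ≤ 2
    have h1 : ((5773 : ℝ) / 10000) ^ 4 * ((k₂ : ℝ) + 1) ≤ ((5773 : ℝ) / 10000) ^ 4 * ((17 : ℝ) + 1) := mul_le_mul_of_nonneg_left (by linarith) (by positivity)
    have h2 : ((5773 : ℝ) / 10000) ^ 4 * ((17 : ℝ) + 1) ≤ 2 := by norm_num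
    linarith
  · -- p₂⁴(k₃+1) ≤ k₂+1
    have t := mul_le_mul_of_nonneg_left hrhi' (show (0 : ℝ) ≤ ((7311 : ℝ) / 10000) ^ 4 / 2 by norm_num)
    have h2 : ((7311 : ℝ) / 10000) ^ 4 / 2 * 7 ≤ 1 := by norm_num
    have h3 := mul_le_mul_of_nonneg_right h2 (show (0 : ℝ) ≤ (k₂ : ℝ) + 1 by positivity)
    linarith [t, h3]
  · -- √2∕(1+p₁) ≤ σ₁
    rw [div_le_iff₀ (by norm_num)]; linarith [hs99]
  · -- √2∕(1+p₂) ≤ σ₂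
    rw [div_le_iff₀ (by norm_num)]; linarith [hs99]
  · -- 2(k₂+1)∕k₃ ≤ E
    rw [div_le_iff₀ hk3pos]; linarith [hrlo']
  · -- 4∕k₂ ≤ B
    exact div_le_div_of_nonneg_left (by norm_num) (by norm_num) hk2lo'
  · -- 4∕k₃ ≤ C
    rw [div_le_iff₀ hk3pos]; linarith [hrlo', hk2lo']

/-- **JOINT BAND `17 ≤ k₂ ≤ 17`, `7/2·(k₂+1) ≤ k₃`, `k₃+1 ≤ 15/4·(k₂+1)` ⟹ THE END** ((E93b) `flow_nonneg_census_three_ages_two_pairs` with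
`s = 14143/20000`, `p₁ = 5773/10000`, `σ₁ = 17933/20000`, `p₂ = 3593/5000`, `σ₂ = 82293/100000`, `E = 18/31`, `B = 4/17`, `C = 2/31`; exact rational certificate, margin `0.0015`). [folklore] -/
theorem joint_band_k17_17_r7_2_15_4 (hmono : ∀ u v : ℕ → ℝ, SeqBox γ u → SeqBox γ v → (∀ j, u j ≤ v j) → B u ≤ B v)
    (hL : ∀ k, 0 ≤ L k) (hb : 0 < b) (hlo : ∀ u, SeqBox γ u → b ≤ B u) (hdom : ∀ u, SeqBox γ u → ∑ k ∈ range K, L k * u k ≤ B u)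
    (hh : SeqBox γ h) (hf : MemFlow B gIR h) (hg : ∀ t, 0 < g t ∧ g t ≤ 1)
    (hgF : ∀ t, 1 ≤ g t * (1 + ∑ k ∈ range K, L k * h (t + k) ^ 3 / 2))
    {k₂ k₃ : ℕ} (hk2lo : 17 ≤ k₂) (hk2hi : k₂ ≤ 17) (hrlo : 7 * (k₂ + 1) ≤ 2 * (k₃ + 1)) (hrhi : 4 * (k₃ + 1) ≤ 15 * (k₂ + 1)) (hk3K : k₃ < K)
    (hL3 : ∀ j, j < K → j ≠ 1 → j ≠ k₂ → j ≠ k₃ → L j = 0)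
    {N : ℕ} {KL : ℕ → ℕ → ℕ → ℝ}
    (hKL : ∀ k n l, KL k n l = if 0 < k ∧ k < K ∧ l < k then L k * h (n + k) ^ 3 / 2 * ∏ t ∈ Ico (n + 1 + l) (n + k + 1), g t else 0)
    {KA : ℕ → ℕ → ℕ → ℝ} {RA : ℕ → (ℕ → ℝ) → ℕ → ℝ}
    (hRA : ∀ i v m, RA i v m = ∑ l ∈ range K, KA i m l * v (m + 1 + l))
    (hKA : ∀ i m l, KA i m l = KL i m l + KA (i + 1) m l) (hKAtop : ∀ m l, KA K m l = 0)
    {e ε : ℕ → ℝ} (he0 : ∀ m, 0 ≤ e m) (hea : ∀ m, e (m + 1) ≤ e m)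
    (hεt : ∀ m, N < m → ε m = 0) (hεrec : ∀ m, ε m = e m - RA 1 ε m) : ∀ m, 0 ≤ ε m ∧ ε m ≤ e m := by
  have hs99 : Real.sqrt 2 ≤ 99 / 70 := Real.sqrt_le_iff.mpr ⟨by norm_num, by norm_num⟩
  have hk2lo' : (17 : ℝ) ≤ k₂ := by exact_mod_cast hk2lo
  have hk2hi' : (k₂ : ℝ) ≤ 17 := by exact_mod_cast hk2hi
  have hrlo' : (7 : ℝ) * ((k₂ : ℝ) + 1) ≤ 2 * ((k₃ : ℝ) + 1) := by exact_mod_cast hrlo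
  have hrhi' : (4 : ℝ) * ((k₃ : ℝ) + 1) ≤ 15 * ((k₂ : ℝ) + 1) := by exact_mod_cast hrhi
  have hk3pos : (0 : ℝ) < k₃ := by exact_mod_cast (show 0 < k₃ by omega)
  refine flow_nonneg_census_three_ages_two_pairs hmono hL hb hlo hdom hh hf hg hgF (by omega) (by omega) hk3K hL3
    (p₁ := ((5773 : ℝ) / 10000)) (p₂ := ((3593 : ℝ) / 5000)) (by norm_num) ?_ (by norm_num) ?_
    (s := ((14143 : ℝ) / 20000)) (σ₁ := ((17933 : ℝ) / 20000)) (σ₂ := ((82293 : ℝ) / 100000)) (E := ((18 : ℝ) / 31)) (Bc := ((4 : ℝ) / 17)) (Cc := ((2 : ℝ) / 31))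
    (by linarith [hs99]) (by norm_num) ?_ ?_ ?_ (by norm_num) ?_ ?_ (by norm_num)
    (b₁ := ((5789 : ℝ) / 50000)) (a₂ := ((379 : ℝ) / 2000)) (ρ₁ := ((6553529751 : ℝ) / 31000000000)) (ρ₂ := ((6553529751 : ℝ) / 31000000000)) (ρ₃ := ((6553529751 : ℝ) / 31000000000)) (ρ₄ := ((6553529751 : ℝ) / 31000000000))
    (Or.inr (by norm_num)) (by norm_num) (by norm_num) (by norm_num)
    (fun h => absurd h (by norm_num)) (fun h => absurd h (by norm_num)) (fun h => absurd h (by norm_num)) (fun h => absurd h (by norm_num))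
    (fun _ => by norm_num) (fun _ => by norm_num) (fun _ => by norm_num) (fun _ => by norm_num)
    (Or.inl (by norm_num)) (by norm_num) (by norm_num) (by norm_num) (by norm_num) (by norm_num)
    hKL hRA hKA hKAtop he0 hea hεt hεrec
  · -- p₁⁴(k₂+1) ≤ 2
    have h1 : ((5773 : ℝ) / 10000) ^ 4 * ((k₂ : ℝ) + 1) ≤ ((5773 : ℝ) / 10000) ^ 4 * ((17 : ℝ) + 1) := mul_le_mul_of_nonneg_left (by linarith) (by positivity)
    have h2 : ((5773 : ℝ) / 10000) ^ 4 * ((17 : ℝ) + 1) ≤ 2 := by norm_num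
    linarith
  · -- p₂⁴(k₃+1) ≤ k₂+1
    have t := mul_le_mul_of_nonneg_left hrhi' (show (0 : ℝ) ≤ ((3593 : ℝ) / 5000) ^ 4 / 4 by norm_num)
    have h2 : ((3593 : ℝ) / 5000) ^ 4 / 4 * 15 ≤ 1 := by norm_num
    have h3 := mul_le_mul_of_nonneg_right h2 (show (0 : ℝ) ≤ (k₂ : ℝ) + 1 by positivity)
    linarith [t, h3]
  · -- √2∕(1+p₁) ≤ σ₁
    rw [div_le_iff₀ (by norm_num)]; linarith [hs99]
  · -- √2∕(1+p₂) ≤ σ₂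
    rw [div_le_iff₀ (by norm_num)]; linarith [hs99]
  · -- 2(k₂+1)∕k₃ ≤ E
    rw [div_le_iff₀ hk3pos]; linarith [hrlo']
  · -- 4∕k₂ ≤ B
    exact div_le_div_of_nonneg_left (by norm_num) (by norm_num) hk2lo'
  · -- 4∕k₃ ≤ C
    rw [div_le_iff₀ hk3pos]; linarith [hrlo', hk2lo']

/-- **JOINT BAND `17 ≤ k₂ ≤ 17`, `15/4·(k₂+1) ≤ k₃`, `k₃+1 ≤ 17/4·(k₂+1)` ⟹ THE END** ((E93b) `flow_nonneg_census_three_ages_two_pairs` with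
`s = 14143/20000`, `p₁ = 5773/10000`, `σ₁ = 17933/20000`, `p₂ = 1741/2500`, `σ₂ = 8337/10000`, `E = 72/133`, `B = 4/17`, `C = 8/133`; exact rational certificate, margin `0.0018`). [folklore] -/
theorem joint_band_k17_17_r15_4_17_4 (hmono : ∀ u v : ℕ → ℝ, SeqBox γ u → SeqBox γ v → (∀ j, u j ≤ v j) → B u ≤ B v)
    (hL : ∀ k, 0 ≤ L k) (hb : 0 < b) (hlo : ∀ u, SeqBox γ u → b ≤ B u) (hdom : ∀ u, SeqBox γ u → ∑ k ∈ range K, L k * u k ≤ B u)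
    (hh : SeqBox γ h) (hf : MemFlow B gIR h) (hg : ∀ t, 0 < g t ∧ g t ≤ 1)
    (hgF : ∀ t, 1 ≤ g t * (1 + ∑ k ∈ range K, L k * h (t + k) ^ 3 / 2))
    {k₂ k₃ : ℕ} (hk2lo : 17 ≤ k₂) (hk2hi : k₂ ≤ 17) (hrlo : 15 * (k₂ + 1) ≤ 4 * (k₃ + 1)) (hrhi : 4 * (k₃ + 1) ≤ 17 * (k₂ + 1)) (hk3K : k₃ < K)
    (hL3 : ∀ j, j < K → j ≠ 1 → j ≠ k₂ → j ≠ k₃ → L j = 0)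
    {N : ℕ} {KL : ℕ → ℕ → ℕ → ℝ}
    (hKL : ∀ k n l, KL k n l = if 0 < k ∧ k < K ∧ l < k then L k * h (n + k) ^ 3 / 2 * ∏ t ∈ Ico (n + 1 + l) (n + k + 1), g t else 0)
    {KA : ℕ → ℕ → ℕ → ℝ} {RA : ℕ → (ℕ → ℝ) → ℕ → ℝ}
    (hRA : ∀ i v m, RA i v m = ∑ l ∈ range K, KA i m l * v (m + 1 + l))
    (hKA : ∀ i m l, KA i m l = KL i m l + KA (i + 1) m l) (hKAtop : ∀ m l, KA K m l = 0)
    {e ε : ℕ → ℝ} (he0 : ∀ m, 0 ≤ e m) (hea : ∀ m, e (m + 1) ≤ e m)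
    (hεt : ∀ m, N < m → ε m = 0) (hεrec : ∀ m, ε m = e m - RA 1 ε m) : ∀ m, 0 ≤ ε m ∧ ε m ≤ e m := by
  have hs99 : Real.sqrt 2 ≤ 99 / 70 := Real.sqrt_le_iff.mpr ⟨by norm_num, by norm_num⟩
  have hk2lo' : (17 : ℝ) ≤ k₂ := by exact_mod_cast hk2lo
  have hk2hi' : (k₂ : ℝ) ≤ 17 := by exact_mod_cast hk2hi
  have hrlo' : (15 : ℝ) * ((k₂ : ℝ) + 1) ≤ 4 * ((k₃ : ℝ) + 1) := by exact_mod_cast hrlo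
  have hrhi' : (4 : ℝ) * ((k₃ : ℝ) + 1) ≤ 17 * ((k₂ : ℝ) + 1) := by exact_mod_cast hrhi
  have hk3pos : (0 : ℝ) < k₃ := by exact_mod_cast (show 0 < k₃ by omega)
  refine flow_nonneg_census_three_ages_two_pairs hmono hL hb hlo hdom hh hf hg hgF (by omega) (by omega) hk3K hL3
    (p₁ := ((5773 : ℝ) / 10000)) (p₂ := ((1741 : ℝ) / 2500)) (by norm_num) ?_ (by norm_num) ?_
    (s := ((14143 : ℝ) / 20000)) (σ₁ := ((17933 : ℝ) / 20000)) (σ₂ := ((8337 : ℝ) / 10000)) (E := ((72 : ℝ) / 133)) (Bc := ((4 : ℝ) / 17)) (Cc := ((8 : ℝ) / 133))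
    (by linarith [hs99]) (by norm_num) ?_ ?_ ?_ (by norm_num) ?_ ?_ (by norm_num)
    (b₁ := ((2531 : ℝ) / 20000)) (a₂ := ((379 : ℝ) / 2000)) (ρ₁ := ((11030711913 : ℝ) / 53200000000)) (ρ₂ := ((11030711913 : ℝ) / 53200000000)) (ρ₃ := ((11030711913 : ℝ) / 53200000000)) (ρ₄ := ((11030711913 : ℝ) / 53200000000))
    (Or.inr (by norm_num)) (by norm_num) (by norm_num) (by norm_num)
    (fun h => absurd h (by norm_num)) (fun h => absurd h (by norm_num)) (fun h => absurd h (by norm_num)) (fun h => absurd h (by norm_num))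
    (fun _ => by norm_num) (fun _ => by norm_num) (fun _ => by norm_num) (fun _ => by norm_num)
    (Or.inl (by norm_num)) (by norm_num) (by norm_num) (by norm_num) (by norm_num) (by norm_num)
    hKL hRA hKA hKAtop he0 hea hεt hεrec
  · -- p₁⁴(k₂+1) ≤ 2
    have h1 : ((5773 : ℝ) / 10000) ^ 4 * ((k₂ : ℝ) + 1) ≤ ((5773 : ℝ) / 10000) ^ 4 * ((17 : ℝ) + 1) := mul_le_mul_of_nonneg_left (by linarith) (by positivity)
    have h2 : ((5773 : ℝ) / 10000) ^ 4 * ((17 : ℝ) + 1) ≤ 2 := by norm_num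
    linarith
  · -- p₂⁴(k₃+1) ≤ k₂+1
    have t := mul_le_mul_of_nonneg_left hrhi' (show (0 : ℝ) ≤ ((1741 : ℝ) / 2500) ^ 4 / 4 by norm_num)
    have h2 : ((1741 : ℝ) / 2500) ^ 4 / 4 * 17 ≤ 1 := by norm_num
    have h3 := mul_le_mul_of_nonneg_right h2 (show (0 : ℝ) ≤ (k₂ : ℝ) + 1 by positivity)
    linarith [t, h3]
  · -- √2∕(1+p₁) ≤ σ₁
    rw [div_le_iff₀ (by norm_num)]; linarith [hs99]
  · -- √2∕(1+p₂) ≤ σ₂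
    rw [div_le_iff₀ (by norm_num)]; linarith [hs99]
  · -- 2(k₂+1)∕k₃ ≤ E
    rw [div_le_iff₀ hk3pos]; linarith [hrlo']
  · -- 4∕k₂ ≤ B
    exact div_le_div_of_nonneg_left (by norm_num) (by norm_num) hk2lo'
  · -- 4∕k₃ ≤ C
    rw [div_le_iff₀ hk3pos]; linarith [hrlo', hk2lo']

end Summit.QuantumFields.BalabanUV.Beta.EriceRemainderEnclosureHistoryAutonomyComparisonAgeCompositionTwoPairsBandsH

end
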